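import Summits.FinalStateConjecture.FinalStateConjecture.Theorems.PhotonSphereChannelsWindowedShellChannelsStubNearFarAdditivity
import Summits.FinalStateConjecture.FinalStateConjecture.Theorems.PhotonSphereChannelsWindowedShellChannelsStubNearHalfShare
import Summits.FinalStateConjecture.FinalStateConjecture.Theorems.PhotonSphereChannelsWindowedShellChannelsStubParity
import Summits.FinalStateConjecture.FinalStateConjecture.Theorems.WindowedShellChannels.Negative.LaggedApertures
import Literature.Analysis.PDE.Wave1DSpatialReflection
import Literature.Analysis.PDE.Wave1DExteriorEnergy

/-!
# Crux `WindowedShellChannels` (stmt-FinalStateConjecture-14085), line `Sketch` — glue toolkit, part 1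
# (one-sided windowed energies: reflection, splitting, invisibility, parity, limits)

General-potential bookkeeping for the composition `stub_glue` of skeleton v8 (lead c3).  For a
differentiable `V ≥ 0` and global `C²` solutions of `ψ_tt − ψ_xx + Vψ = 0`:

* spatial reflection `ψ♭(t,x) = ψ(t,−x)` is a solution for `V(−x)` with the reflected energy density,
  the same total energy, and its FAR energy beyond the edge `a` is the NEAR (left) windowed energy of `ψ`
  below `−a` (`farEnergy_reflect`);
* for `0 ≤ a + |t|` the two-sided exterior energy of aperture `a` about `0` is the far energy beyond `a`
  plus the far energy of the reflection (`exteriorEnergy_eq_far_add_reflect`);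
* a summand whose data are supported in `(−∞, B)` with `B ≤ a` is invisible in the far window beyond `a`
  (`farEnergy_add_near_eq`), and two summands with data in `(−∞, A)` / `(B, ∞)` have additive far
  energies at every time `T ≥ 0` with `A + T < B − T` (`farEnergy_add_eq_of_separated`);
* parity-pure solutions have time-symmetric far energies (`farChannelEnergy_atBot_eq_atTop'`);
* the far energy is monotone in the edge and converges along `atTop` to the far channel energy
  (`tendsto_farEnergy_atTop`), which it dominates at every `t ≥ 0` (`farChannelEnergy_le_farEnergy`).

No definitions. [folklore]
-/

noncomputable section

set_option linter.dupNamespace false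

open Set Filter Topology Function MeasureTheory
open scoped ENNReal

namespace Summit.FinalStateConjecture.FinalStateConjecture.Theorems.WindowedShellChannelsSketch

open Literature.Geometry.Lorentzian Literature.Geometry.Lorentzian.ReggeWheeler
open Literature.Analysis.PDE
open Summit.FinalStateConjecture.FinalStateConjecture.Theorems
open Summit.FinalStateConjecture.FinalStateConjecture.Theorems.CauchyWaveGlobal
open Summit.FinalStateConjecture.FinalStateConjecture.Theorems.WindowedShellChannelsSplit
open Summit.FinalStateConjecture.FinalStateConjecture.Theorems.WindowedShellChannelsStubs

namespace Glue

variable {V : ℝ → ℝ} {ψ u n f : ℝ → ℝ → ℝ} {σ : ℝ}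

/-! ### Spatial reflection -/

/-- The reflection `ψ(t, −x)` of a global solution solves the equation with potential `V(−x)`. [folklore] -/
theorem isSolution_reflect (hψ : IsSolution V ψ) :
    IsSolution (fun x => V (-x)) (fun t x => ψ t (-x)) := by
  obtain ⟨hC, hsol, -⟩ := wave1D_spatialReflection hψ.1 (fun t x => hψ.2 (t, x))
  exact ⟨hC, fun z => hsol z.1 z.2⟩

/-- The energy density of the reflection is the reflected energy density. [folklore] -/
theorem energyDensity_reflect (hψ : IsSolution V ψ) (t x : ℝ) :
    energyDensity (fun x => V (-x)) (fun t x => ψ t (-x)) t x = energyDensity V ψ t (-x) := by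
  obtain ⟨-, -, he⟩ := wave1D_spatialReflection hψ.1 (fun t x => hψ.2 (t, x))
  unfold energyDensity
  exact he t x

/-- Reflection preserves the total energy. [folklore] -/
theorem totalEnergy_reflect (hψ : IsSolution V ψ) (t : ℝ) :
    totalEnergy (fun x => V (-x)) (fun t x => ψ t (-x)) t = totalEnergy V ψ t := by
  unfold totalEnergy
  simp_rw [energyDensity_reflect hψ]
  exact lintegral_neg_eq_self (fun x => ENNReal.ofReal (energyDensity V ψ t x))

/-- The far energy of the reflection beyond the edge `a` is the windowed energy of `ψ` below `−a`.
[folklore] -/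
theorem farEnergy_reflect (hψ : IsSolution V ψ) (a t : ℝ) :
    farEnergy (fun x => V (-x)) a (fun t x => ψ t (-x)) t
      = ∫⁻ x in Iio (-(a + |t|)), ENNReal.ofReal (energyDensity V ψ t x) := by
  unfold farEnergy
  simp_rw [energyDensity_reflect hψ]
  have h := lintegral_Iio_reflect (fun x => ENNReal.ofReal (energyDensity V ψ t (-x))) (a + |t|)
  simp only [neg_neg] at h
  change ∫⁻ x in Ioi (a + |t|), ENNReal.ofReal (energyDensity V ψ t (-x)) = _
  exact h.symm

/-- Reflection preserves a time parity. [folklore] -/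
theorem parity_reflect (hpar : ∀ t x, ψ (-t) x = σ * ψ t x) :
    ∀ t x, (fun t x => ψ t (-x)) (-t) x = σ * (fun t x => ψ t (-x)) t x :=
  fun t x => hpar t (-x)

/-- Cauchy data supported in `(−∞, −B)` reflect to Cauchy data supported in `(B, ∞)`. [folklore] -/
theorem supported_reflect_Iio {B : ℝ} (h : CauchyDataSupportedOn ψ (Iio (-B))) :
    CauchyDataSupportedOn (fun t x => ψ t (-x)) (Ioi B) := by
  intro x hx
  have hx' : -x ∉ Iio (-B) := by
    simp only [mem_Iio, not_lt, neg_le_neg_iff]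
    simpa only [mem_Ioi, not_lt] using hx
  exact h (-x) hx'

/-- Cauchy data supported in `[−R, R]` reflect to Cauchy data supported in `[−R, R]`. [folklore] -/
theorem supported_reflect_Icc {R : ℝ} (h : CauchyDataSupportedOn ψ (Icc (-R) R)) :
    CauchyDataSupportedOn (fun t x => ψ t (-x)) (Icc (-R) R) := by
  intro x hx
  have hx' : -x ∉ Icc (-R) R := by
    simp only [mem_Icc, not_and_or, not_le] at hx ⊢
    rcases hx with hx | hx
    · right; linarith
    · left; linarith
  exact h (-x) hx'

/-- Enlarging the support set keeps `CauchyDataSupportedOn`. [folklore] -/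
theorem supported_mono {S T : Set ℝ} (h : CauchyDataSupportedOn ψ S) (hST : S ⊆ T) :
    CauchyDataSupportedOn ψ T := fun x hx => h x fun hxS => hx (hST hxS)

/-! ### Splitting the exterior energy into the two one-sided windows -/

/-- For `0 ≤ a + |t|` the exterior energy of aperture `a` about `0` is the far energy beyond the edge
`a` plus the far energy of the reflected solution. [folklore] -/
theorem exteriorEnergy_eq_far_add_reflect (hψ : IsSolution V ψ) {a t : ℝ}
    (hat : 0 ≤ a + |t|) :
    exteriorEnergy V 0 a ψ t
      = farEnergy V a ψ t + farEnergy (fun x => V (-x)) a (fun t x => ψ t (-x)) t := by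
  rw [farEnergy_reflect hψ]
  unfold exteriorEnergy farEnergy
  have hset : {x : ℝ | a + |t| < |x - 0|} = {x : ℝ | a + |t| < x} ∪ Iio (-(a + |t|)) := by
    ext x
    simp only [sub_zero, mem_setOf_eq, mem_union, mem_Iio]
    constructor
    · intro h
      rcases le_or_gt 0 x with hx | hx
      · left; rwa [abs_of_nonneg hx] at h
      · right; rw [abs_of_neg hx] at h; linarith
    · rintro (h | h)
      · rwa [abs_of_pos (lt_of_le_of_lt hat h)]
      · have hx : x < 0 := by linarith
        rw [abs_of_neg hx]; linarith
  have hdisj : Disjoint {x : ℝ | a + |t| < x} (Iio (-(a + |t|))) := by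
    rw [Set.disjoint_left]
    intro x hx hx'
    simp only [mem_setOf_eq, mem_Iio] at hx hx'
    linarith
  rw [hset, lintegral_union measurableSet_Iio hdisj]

/-! ### Invisibility and additivity in the far window -/

/-- A solution with data in `(−∞, B)` vanishes to first order near every point of the open region
`{B + |t| < x}`. [folklore] -/
theorem firstOrder_vanish_near (hV : Differentiable ℝ V) (hV0 : ∀ x, 0 ≤ V x) (hn : IsSolution V n)
    {B : ℝ} (hsupp : CauchyDataSupportedOn n (Iio B)) {t x : ℝ} (hx : B + |t| < x) :
    n t x = 0 ∧ deriv (fun τ => n τ x) t = 0 ∧ deriv (n t) x = 0 := by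
  refine firstOrder_vanish_of_eventually ?_
  have ho : IsOpen {w : ℝ × ℝ | B + |w.1| < w.2} := isOpen_lt (by fun_prop) (by fun_prop)
  filter_upwards [ho.mem_nhds (show (t, x) ∈ {w : ℝ × ℝ | B + |w.1| < w.2} from hx)] with w hw
  exact NearFarAdditivity.near_eq_zero hV hV0 hn hsupp (le_of_lt hw)

/-- **Invisibility**: a summand with data in `(−∞, B)`, `B ≤ a`, does not change the far energy
beyond the edge `a`. [folklore] -/
theorem farEnergy_add_near_eq (hV : Differentiable ℝ V) (hV0 : ∀ x, 0 ≤ V x) (hu : IsSolution V u)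
    (hn : IsSolution V n) {B a : ℝ} (hsupp : CauchyDataSupportedOn n (Iio B)) (hBa : B ≤ a) (t : ℝ) :
    farEnergy V a (fun t x => u t x + n t x) t = farEnergy V a u t := by
  unfold farEnergy
  refine setLIntegral_congr_fun measurableSet_Ioi fun x hx => ?_
  have hx' : B + |t| < x := lt_of_le_of_lt (by linarith) hx
  obtain ⟨h0, h1, h2⟩ := firstOrder_vanish_near hV hV0 hn hsupp hx'
  have h := energyDensity_add_of_right_vanish (V := V) hu.1 hn.1 h0 h1 h2
  simp only [one_mul] at h
  rw [h]

/-- **Additivity before contact**: summands with data in `(−∞, A)` and `(B, ∞)` have additive far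
energies at every time `t` with `A + |t| < B − |t|` (their supports have not met). [folklore] -/
theorem farEnergy_add_eq_of_separated (hV : Differentiable ℝ V) (hV0 : ∀ x, 0 ≤ V x)
    (hn : IsSolution V n) (hf : IsSolution V f) {A B : ℝ} (hsn : CauchyDataSupportedOn n (Iio A))
    (hsf : CauchyDataSupportedOn f (Ioi B)) (a : ℝ) {t : ℝ} (ht : A + |t| < B - |t|) :
    farEnergy V a (fun t x => n t x + f t x) t = farEnergy V a n t + farEnergy V a f t := by
  unfold farEnergy
  rw [← lintegral_add_left (Parity.measurable_energyDensity hV.continuous hn.1 t)]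
  refine setLIntegral_congr_fun measurableSet_Ioi fun x _ => ?_
  have hx : A + |t| < x ∨ x < B - |t| := by
    rcases lt_or_ge x (B - |t|) with h | h
    · exact Or.inr h
    · exact Or.inl (lt_of_lt_of_le ht h)
  rw [NearFarAdditivity.energyDensity_add_eq hV hV0 hn hf hsn hsf hx, ENNReal.ofReal_add
    (energyDensity_nonneg n t (hV0 x)) (energyDensity_nonneg f t (hV0 x))]

/-! ### Parity and the far channel -/

/-- For a parity-`σ` function with `σ² = 1` the far energy is even in time. [folklore] -/
theorem farEnergy_neg (hpar : ∀ t x, ψ (-t) x = σ * ψ t x) (hσ : σ ^ 2 = 1) (a t : ℝ) :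
    farEnergy V a ψ (-t) = farEnergy V a ψ t := by
  unfold farEnergy
  rw [abs_neg]
  exact lintegral_congr fun x => by rw [NearHalfShare.energyDensity_neg hpar hσ]

/-- For a parity-`σ` function with `σ² = 1` the backward far channel energy equals the forward one.
[folklore] -/
theorem farChannelEnergy_atBot_eq_atTop (hpar : ∀ t x, ψ (-t) x = σ * ψ t x) (hσ : σ ^ 2 = 1)
    (a : ℝ) : farChannelEnergy V a ψ atBot = farChannelEnergy V a ψ atTop := by
  unfold farChannelEnergy
  have hcomp : farEnergy V a ψ = (farEnergy V a ψ) ∘ Neg.neg := by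
    funext t
    simp only [Function.comp_apply]
    rw [farEnergy_neg hpar hσ]
  conv_lhs => rw [hcomp]
  rw [Filter.liminf_comp, Filter.map_neg_atBot]

/-- The same for every `σ` (if `σ² ≠ 1` the function vanishes). [folklore] -/
theorem farChannelEnergy_atBot_eq_atTop' (hpar : ∀ t x, ψ (-t) x = σ * ψ t x) (a : ℝ) :
    farChannelEnergy V a ψ atBot = farChannelEnergy V a ψ atTop := by
  by_cases hσ : σ ^ 2 = 1
  · exact farChannelEnergy_atBot_eq_atTop hpar hσ a
  · exact farChannelEnergy_atBot_eq_atTop (NearHalfShare.even_of_parity hpar hσ) (by norm_num) a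

/-! ### Monotonicity in the edge, limits -/

/-- A smaller edge gives a larger far window. [folklore] -/
theorem farEnergy_mono_edge {a a' : ℝ} (h : a' ≤ a) (t : ℝ) :
    farEnergy V a ψ t ≤ farEnergy V a' ψ t := by
  unfold farEnergy
  refine lintegral_mono_set fun x hx => ?_
  simp only [mem_setOf_eq] at hx ⊢
  linarith

/-- A smaller edge gives a larger far channel energy. [folklore] -/
theorem farChannelEnergy_mono_edge {a a' : ℝ} (h : a' ≤ a) (l : Filter ℝ) :
    farChannelEnergy V a ψ l ≤ farChannelEnergy V a' ψ l :=
  Filter.liminf_le_liminf (Eventually.of_forall fun t => farEnergy_mono_edge h t)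

/-- The far energy is non-increasing on `t ≥ 0`. [folklore] -/
theorem farEnergy_antitone (hV : Continuous V) (hV0 : ∀ x, 0 ≤ V x) (hψ : IsSolution V ψ) (a : ℝ)
    {s t : ℝ} (hs : 0 ≤ s) (hst : s ≤ t) : farEnergy V a ψ t ≤ farEnergy V a ψ s := by
  unfold farEnergy energyDensity
  exact wave1D_farEnergy_mono_of_nonneg hV hV0 hψ.1 (fun t x => hψ.2 (t, x)) a hs hst

/-- The far channel energy is dominated by the far energy at every time `T ≥ 0`. [folklore] -/
theorem farChannelEnergy_le_farEnergy (hV : Continuous V) (hV0 : ∀ x, 0 ≤ V x) (hψ : IsSolution V ψ)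
    (a : ℝ) {T : ℝ} (hT : 0 ≤ T) : farChannelEnergy V a ψ atTop ≤ farEnergy V a ψ T := by
  unfold farChannelEnergy
  refine liminf_le_of_frequently_le' (Eventually.frequently ?_)
  filter_upwards [eventually_ge_atTop T] with t ht
  exact farEnergy_antitone hV hV0 hψ a hT ht

/-- **The far energy converges to the far channel energy** along `atTop`. [folklore] -/
theorem tendsto_farEnergy_atTop (hV : Continuous V) (hV0 : ∀ x, 0 ≤ V x) (hψ : IsSolution V ψ)
    (a : ℝ) : Tendsto (farEnergy V a ψ) atTop (𝓝 (farChannelEnergy V a ψ atTop)) := by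
  set g : ℝ → ℝ≥0∞ := fun t => farEnergy V a ψ (max t 0) with hg_def
  have hg : Antitone g := fun t t' htt' =>
    farEnergy_antitone hV hV0 hψ a (le_max_right _ _) (max_le_max htt' le_rfl)
  have hlim : Tendsto g atTop (𝓝 (⨅ t, g t)) := tendsto_atTop_iInf hg
  have heq : farEnergy V a ψ =ᶠ[atTop] g := by
    filter_upwards [eventually_ge_atTop 0] with t ht
    simp only [hg_def, max_eq_left ht]
  have hlim' : Tendsto (farEnergy V a ψ) atTop (𝓝 (⨅ t, g t)) := hlim.congr' heq.symm
  have hli : farChannelEnergy V a ψ atTop = ⨅ t, g t := by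
    unfold farChannelEnergy
    exact hlim'.liminf_eq
  rw [hli]
  exact hlim'

/-- Consequently the far energy is eventually within any `δ > 0` of the far channel energy (when the
latter is finite). [folklore] -/
theorem eventually_farEnergy_le_add (hV : Continuous V) (hV0 : ∀ x, 0 ≤ V x) (hψ : IsSolution V ψ)
    (a : ℝ) (hfin : farChannelEnergy V a ψ atTop ≠ ⊤) {δ : ℝ≥0∞} (hδ : 0 < δ) :
    ∀ᶠ t in atTop, farEnergy V a ψ t ≤ farChannelEnergy V a ψ atTop + δ := by
  have h := tendsto_farEnergy_atTop hV hV0 hψ a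
  have hlt : farChannelEnergy V a ψ atTop < farChannelEnergy V a ψ atTop + δ :=
    ENNReal.lt_add_right hfin hδ.ne'
  filter_upwards [(tendsto_order.1 h).2 _ hlt] with t ht
  exact ht.le

end Glue

/-- **Registered principal statement of this toolkit** (`glueToolkit_exteriorSplit`): for `0 ≤ a + |t|`
the exterior energy of aperture `a` about `0` splits into the far energy beyond `a` and the far energy
of the spatial reflection. [folklore] -/
theorem glueToolkit_exteriorSplit : ∀ (V : ℝ → ℝ) (ψ : ℝ → ℝ → ℝ), IsSolution V ψ → ∀ a t : ℝ,
    0 ≤ a + |t| → exteriorEnergy V 0 a ψ t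
      = farEnergy V a ψ t + farEnergy (fun x => V (-x)) a (fun t x => ψ t (-x)) t :=
  fun _ _ hψ _ _ hat => Glue.exteriorEnergy_eq_far_add_reflect hψ hat

end Summit.FinalStateConjecture.FinalStateConjecture.Theorems.WindowedShellChannelsSketch

end
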